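import Summits.QuantumFields.GaugeBoot.RightShiftRowsUnitary
import Summits.QuantumFields.GaugeBoot.BootstrapSymmetryReduction
import Summits.QuantumFields.GaugeBoot.BootstrapArchimedean
import Summits.QuantumFields.GaugeBoot.WordSpaces
import HarnessLib

/-!
# Truncated right rows: the left loop equations of the test functions of length `≤ n + 2` imply the RIGHT loop equations of the test functions of length `≤ n` (gauge-boot, L1/L4 supplement)

HONEST FRAMING (cell `pub-gaugeboot`, page 1 of every file): the venture produces certified bounds
on lattice expectations at stated coupling, gauge group, dimension and torus size; NOT a mass gap,
NOT a continuum limit, NOT a string tension; NOT Yang–Mills-summit-bearing (barriers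
`FixedCouplingUltralocality`, `PerturbativeInvisibility`). Structural; it certifies no number.

## Content (the level bookkeeping behind the reflection cuts)

`RightShiftRows`: for the UNTRUNCATED bootstrap the left one-link loop equations imply the right
ones — the right derivative of `f` along `U_i ↦ U_i e^{tX}` is the linear left derivative at the
conjugated generator `Y(U) = ρ(U_i) X ρ(U_i)⁻¹ = Σ_j c_j(Y) X_j`, and the right row of `f` follows
from the LEFT rows of the test functions `c_j(Y(U)) · f` (Leibniz; divergence-free coordinates).
The coordinates `c_j(Y(U))` are words of length `2` in the entries of `U_i`, so:

* `IsRightRowsOn r k S β V φ` — the right rows for the test functions of `V` only;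
* ★★ `isRightRowsOn_of_leftRows` (any lattice, abstract direction family as in `RightShiftRows`)
  — left rows for the test set `W ⊇ {c_j(Y) f : f ∈ V}` ⇒ right rows for `V`;
* `coefAdjDir_mem_wordTruncation_two_suN` — for `SU(N)` the coordinate observables
  `½ Re/Im (ρ(U_i) X ρ(U_i)⁻¹)_{ab}` are level-`2` test functions;
* ★★★ `isRightRowsOn_of_isBootstrapFeasible_suN` — `SU(N)` torus: a level-`(n+2)` feasible
  functional satisfies the RIGHT loop equations of every level-`n` test function. (Sequel
  `BootstrapReflectionCutLevels`: hence reflection cuts at level `n` cost at most two levels.)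

References: M. Creutz, Quarks, gluons and lattices (1983) Ch. 8; folklore.
-/

noncomputable section

open Filter Topology NormedSpace
open scoped Matrix.Norms.Frobenius Matrix
open Literature.MathematicalPhysics.QuantumFieldTheory (LatticeRep)

namespace Summit.QuantumFields.GaugeBoot

variable {ι : Type*} {G : Type*} [Group G] [TopologicalSpace G] (r : LatticeRep G)

/-! ## Right rows on a test set -/

section Defs

variable [DecidableEq ι] {K : Type*}

/-- **Right loop equations for the test functions of `V`**: for every link `i` and direction `a`
the local action has a polynomial RIGHT derivative `S'` and `φ f' = β φ (f S')` for every `f ∈ V`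
with polynomial right derivative `f'`. [shape] A parametric definition of a proposition — NOT a
fact. [folklore] -/
def IsRightRowsOn (k : K → ℝ → G) (S : ι → (ι → G) → ℝ) (β : ℝ) (V : Set C(ι → G, ℝ))
    (φ : C(ι → G, ℝ) →ₗ[ℝ] ℝ) : Prop :=
  ∀ (i : ι) (a : K), ∃ S' ∈ polyAlgebra (ι := ι) r,
    (∀ U, HasDerivAt (fun t => S i (Function.update U i (U i * k a t))) (S' U) 0) ∧
      ∀ f ∈ V, ∀ f' ∈ polyAlgebra (ι := ι) r,
        (∀ U, HasDerivAt (fun t => f (Function.update U i (U i * k a t))) (f' U) 0) →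
          φ f' = β * φ (f * S')

end Defs

/-! ## Left rows on `W` imply right rows on `V` -/

section Main

variable {K : Type*} {k : K → ℝ → G} {X : K → Matrix (Fin r.N) (Fin r.N) ℂ} {J : Type*} [Fintype J]
  (dir : J → K) (coef : J → (Matrix (Fin r.N) (Fin r.N) ℂ →ₗ[ℝ] ℝ))

variable [ContinuousMul G] [DecidableEq ι]

/-- ★★ **Truncated form of `IsSDFunctional.isRightSDFunctional`.** Same direction family,
coordinates and divergence-freeness; the LEFT rows are required only for the test set `W`, and the
RIGHT rows follow for every test set `V` of polynomial observables such that `c_j(Y_{i,a}(U)) · f ∈ W`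
for all `f ∈ V` (`hVW`), where `c_j(Y_{i,a}(U)) = coef j (ρ(U_i) X_a ρ(U_i)⁻¹)`. [folklore] -/
theorem isRightRowsOn_of_leftRows (hk : ∀ a s t, k a (s + t) = k a s * k a t)
    (hX : ∀ a t, r.ρ (k a t) = exp ((t : ℂ) • X a))
    (hrep : ∀ (a : K) (g : G),
      r.ρ g * X a * r.ρ g⁻¹ = ∑ j, coef j (r.ρ g * X a * r.ρ g⁻¹) • X (dir j))
    (hdiv : ∀ (j : J) (a : K) (g : G),
      coef j (X (dir j) * (r.ρ g * X a * r.ρ g⁻¹) - (r.ρ g * X a * r.ρ g⁻¹) * X (dir j)) = 0)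
    (hcoef : ∀ j, PreservesPoly (ι := ι) r (coef j))
    {S : ι → (ι → G) → ℝ} (hS : ∀ i, S i ∈ polyFunctions (ι := ι) r) {β : ℝ}
    {V W : Set C(ι → G, ℝ)} (hV : V ⊆ polyAlgebra (ι := ι) r)
    (hVW : ∀ (i : ι) (a : K) (j : J) (g : C(ι → G, ℝ)), g ∈ polyAlgebra (ι := ι) r →
      (⇑g = fun U => coef j (adjDir r i (X a) U)) → ∀ f ∈ V, g * f ∈ W)
    {φ : C(ι → G, ℝ) →ₗ[ℝ] ℝ}
    (hrowsW : ∀ (i : ι) (a : K), ∃ S' ∈ polyAlgebra (ι := ι) r,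
      (∀ U, HasDerivAt (fun t => S i (Function.update U i (k a t * U i))) (S' U) 0) ∧
        ∀ f ∈ W, ∀ f' ∈ polyAlgebra (ι := ι) r,
          (∀ U, HasDerivAt (fun t => f (Function.update U i (k a t * U i))) (f' U) 0) →
            φ f' = β * φ (f * S')) :
    IsRightRowsOn r k S β V φ := by
  intro i a
  -- the left data along the finitely many directions `dir j`
  choose Sd hSdm hSd hrow using fun j => hrowsW i (dir j)
  -- the coordinate observables `cf j (U) = coef j (Y U)`, `Y U = ρ(U_i) X_a ρ(U_i⁻¹)`
  have hcfex : ∀ j, ∃ g ∈ polyAlgebra (ι := ι) r, ⇑g = fun U => coef j (adjDir r i (X a) U) := fun j =>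
    (mem_polyFunctions_iff r).1 (hcoef j _ (entriesPoly_adjDir r i (X a)))
  choose cf hcfm hcfe using hcfex
  have hcf : ∀ j U, cf j U = coef j (adjDir r i (X a) U) := fun j U => congrFun (hcfe j) U
  -- their left derivatives along `dir j`: polynomial, with value `coef j [X_{dir j}, Y]`
  choose cfd hcfdm hcfd using fun j => exists_deriv_mem_polyAlgebra r (hk (dir j)) (hX (dir j)) i (hcfm j)
  have hcfd_val : ∀ j U, cfd j U =
      coef j (X (dir j) * adjDir r i (X a) U - adjDir r i (X a) U * X (dir j)) := fun j U => by
    have h1 := hcfd j U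
    have h2 : HasDerivAt (fun t => cf j (Function.update U i (k (dir j) t * U i)))
        (coef j (X (dir j) * adjDir r i (X a) U - adjDir r i (X a) U * X (dir j))) 0 := by
      have h := (LinearMap.toContinuousLinearMap (coef j)).hasFDerivAt.comp_hasDerivAt 0
        (hasDerivAt_adjDir_update r i (X a) (hk (dir j)) (hX (dir j)) U)
      refine h.congr_of_eventuallyEq (Eventually.of_forall fun t => ?_)
      simp only [Function.comp_apply, LinearMap.coe_toContinuousLinearMap', hcf]
    exact h1.unique h2
  -- the divergence vanishes identically
  have hdiv0 : ∑ j, cfd j = 0 := by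
    ext U
    rw [ContinuousMap.coe_sum, Finset.sum_apply, ContinuousMap.zero_apply]
    exact Finset.sum_eq_zero fun j _ => by rw [hcfd_val, adjDir_apply, hdiv j a (U i)]
  -- the right derivative of the action
  set SR : C(ι → G, ℝ) := ∑ j, cf j * Sd j with hSR
  have hSRm : SR ∈ polyAlgebra (ι := ι) r :=
    Subalgebra.sum_mem _ fun j _ => Subalgebra.mul_mem _ (hcfm j) (hSdm j)
  have key : ∀ {F : (ι → G) → ℝ} {D : (ι → G) → Matrix (Fin r.N) (Fin r.N) ℂ →ₗ[ℝ] ℝ},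
      HasLinearShiftDeriv r i F D → ∀ (fd : J → C(ι → G, ℝ)),
      (∀ j U, HasDerivAt (fun t => F (Function.update U i (k (dir j) t * U i))) (fd j U) 0) →
      ∀ U, D U (adjDir r i (X a) U) = (∑ j, cf j * fd j) U := by
    intro F D hD fd hfd U
    rw [adjDir_apply, hrep a (U i), map_sum, ContinuousMap.coe_sum, Finset.sum_apply]
    refine Finset.sum_congr rfl fun j _ => ?_
    rw [map_smul, smul_eq_mul, ContinuousMap.mul_apply, hcf, adjDir_apply,
      hD.eq_of_hasDerivAt (hX (dir j)) (hfd j U)]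
  refine ⟨SR, hSRm, fun U => ?_, fun f hf f' hf'm hf' => ?_⟩
  · obtain ⟨DS, hDS⟩ := exists_hasLinearShiftDeriv_of_mem_polyFunctions r i (hS i)
    have h := hDS.hasDerivAt_rightShift (hX a) U
    rwa [show r.ρ (U i) * X a * r.ρ (U i)⁻¹ = adjDir r i (X a) U from rfl, key hDS Sd hSd U] at h
  · obtain ⟨Df, hDf⟩ := exists_hasLinearShiftDeriv_of_mem_polyAlgebra r i (hV hf)
    choose fd hfdm hfd using fun j => exists_deriv_mem_polyAlgebra r (hk (dir j)) (hX (dir j)) i (hV hf)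
    have hf'eq : f' = ∑ j, cf j * fd j := by
      ext U
      rw [← key hDf fd hfd U]
      exact (hf' U).unique (hDf.hasDerivAt_rightShift (hX a) U)
    -- Leibniz + the left row along `dir j` for the test function `cf j * f ∈ W`
    have hrowj : ∀ j, φ (cf j * fd j) = β * φ (cf j * f * Sd j) - φ (cfd j * f) := fun j => by
      have hderiv : ∀ U, HasDerivAt (fun t => (cf j * f) (Function.update U i (k (dir j) t * U i)))
          ((cfd j * f + cf j * fd j) U) 0 := fun U => by
        have h0 : Function.update U i (k (dir j) 0 * U i) = U := by
          rw [oneParam_zero (hX (dir j)), one_mul, Function.update_eq_self]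
        have h := (hcfd j U).mul (hfd j U)
        simp only [h0] at h
        exact h.congr_of_eventuallyEq (Eventually.of_forall fun t => rfl)
      have h := hrow j (cf j * f) (hVW i a j (cf j) (hcfm j) (hcfe j) f hf) (cfd j * f + cf j * fd j)
        (Subalgebra.add_mem _ (Subalgebra.mul_mem _ (hcfdm j) (hV hf))
          (Subalgebra.mul_mem _ (hcfm j) (hfdm j))) hderiv
      rw [map_add] at h
      linarith
    have hsum1 : ∑ j, cf j * f * Sd j = f * SR := by
      rw [hSR, Finset.mul_sum]
      exact Finset.sum_congr rfl fun j _ => by ring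
    have hsum2 : ∑ j, cfd j * f = (∑ j, cfd j) * f := by rw [Finset.sum_mul]
    calc φ f' = ∑ j, φ (cf j * fd j) := by rw [hf'eq, map_sum]
      _ = β * φ (∑ j, cf j * f * Sd j) - φ (∑ j, cfd j * f) := by
          simp only [hrowj, Finset.sum_sub_distrib, map_sum, Finset.mul_sum]
      _ = β * φ (f * SR) := by rw [hsum1, hsum2, hdiv0, zero_mul, map_zero, sub_zero]

end Main

/-! ## `SU(N)`: level `n + 2` left rows give level `n` right rows -/

section SuN

open Literature.MathematicalPhysics.QuantumLattice

variable {ι : Type*} [DecidableEq ι] (N : ℕ)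

omit [DecidableEq ι] in
/-- **The conjugated generator has entries of word length `2`** (in the entries of `U_i`). -/
theorem entriesIn_adjDir_suN (i : ι) (Xm : Matrix (Fin N) (Fin N) ℂ) :
    EntriesIn (fundamentalLatticeRep N) (Set.univ : Set ι) 2
      (adjDir (ι := ι) (fundamentalLatticeRep N) i Xm) := by
  have h1 : EntriesIn (fundamentalLatticeRep N) (Set.univ : Set ι) 0
      (fun _ : ι → Matrix.specialUnitaryGroup (Fin N) ℂ => Xm) := fun a b =>
    ⟨const_mem_wordFunctions _ _ 0 _, const_mem_wordFunctions _ _ 0 _⟩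
  have h := ((entriesIn_rho (fundamentalLatticeRep N) (Set.mem_univ i) (le_refl 1)).mul
    (fundamentalLatticeRep N) h1).mul (fundamentalLatticeRep N)
    (entriesIn_rho_inv (fundamentalLatticeRep N) (Set.mem_univ i) (le_refl 1))
  have hdeg : (1 + 0 + 1 : ℕ) = 2 := by norm_num
  rw [hdeg] at h
  exact h

omit [DecidableEq ι] in
/-- ★ **The coordinate observables `c_j(Y(U))` are level-`2` test functions** (`SU(N)`, the
matrix-unit coordinates `unitCoef`). -/
theorem coef_adjDir_mem_wordTruncation_two_suN (i : ι) (a : SuGenerator N) (j : Fin N × Fin N × Bool)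
    {g : C(ι → Matrix.specialUnitaryGroup (Fin N) ℂ, ℝ)}
    (hg : ⇑g = fun U => unitCoef N j (adjDir (ι := ι) (fundamentalLatticeRep N) i
      (a : Matrix (Fin N) (Fin N) ℂ) U)) :
    g ∈ wordTruncation (ι := ι) (fundamentalLatticeRep N) 2 := by
  have hE := entriesIn_adjDir_suN (ι := ι) N i (a : Matrix (Fin N) (Fin N) ℂ)
  obtain ⟨b, c, t⟩ := j
  -- the relevant entry (real or imaginary part), halved
  have hmem : (⇑g : (ι → Matrix.specialUnitaryGroup (Fin N) ℂ) → ℝ) ∈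
      wordFunctions (fundamentalLatticeRep N) (Set.univ : Set ι) 2 := by
    cases t
    · have h : ⇑g = (1 / 2 : ℝ) • fun U => (adjDir (ι := ι) (fundamentalLatticeRep N) i
          (a : Matrix (Fin N) (Fin N) ℂ) U b c).re := by
        rw [hg]; funext U; simp [unitCoef, coefRe_apply, div_eq_inv_mul]
      rw [h]
      exact Submodule.smul_mem _ _ (hE b c).1
    · have h : ⇑g = (1 / 2 : ℝ) • fun U => (adjDir (ι := ι) (fundamentalLatticeRep N) i
          (a : Matrix (Fin N) (Fin N) ℂ) U b c).im := by
        rw [hg]; funext U; simp [unitCoef, coefIm_apply, div_eq_inv_mul]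
      rw [h]
      exact Submodule.smul_mem _ _ (hE b c).2
  exact mem_wordTruncation_of_mem_wordSpace _ ((coe_mem_wordFunctions_iff _).1 hmem)

/-- ★★★ **`SU(N)`: level-`(n+2)` feasibility gives the RIGHT loop equations of every level-`n` test
function** (polynomial local actions; any lattice). [folklore] -/
theorem isRightRowsOn_of_isBootstrapFeasible_suN
    {S : ι → (ι → Matrix.specialUnitaryGroup (Fin N) ℂ) → ℝ}
    (hS : ∀ i, S i ∈ polyFunctions (ι := ι) (fundamentalLatticeRep N)) {β : ℝ} {n : ℕ}
    {φ : C(ι → Matrix.specialUnitaryGroup (Fin N) ℂ, ℝ) →ₗ[ℝ] ℝ}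
    (hφ : IsBootstrapFeasible (fundamentalLatticeRep N) (suExp N) S β
      (wordTruncation (ι := ι) (fundamentalLatticeRep N) (n + 2)) φ) :
    IsRightRowsOn (fundamentalLatticeRep N) (suExp N) S β
      (wordTruncation (ι := ι) (fundamentalLatticeRep N) n) φ := by
  have hskew := fun (X : SuGenerator N) (g : Matrix.specialUnitaryGroup (Fin N) ℂ) =>
    star_rho_conj_eq_neg (fundamentalLatticeRep N) (X := (X : Matrix (Fin N) (Fin N) ℂ))
      (skewAdjoint.mem_iff.1 X.2.1) g
  have htr := fun (X : SuGenerator N) (g : Matrix.specialUnitaryGroup (Fin N) ℂ) =>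
    (trace_rho_conj (fundamentalLatticeRep N) (X : Matrix (Fin N) (Fin N) ℂ) g).trans X.2.2
  refine isRightRowsOn_of_leftRows (fundamentalLatticeRep N) (suDir N) (unitCoef N) (suExp_add N)
    (X := fun X : SuGenerator N => (X : Matrix (Fin N) (Fin N) ℂ)) (rho_suExp N) ?_ ?_ ?_ hS
    (wordTruncation_subset_polyAlgebra _ n) ?_ hφ.2.2
  · intro X g
    exact (skewAdjoint_traceless_decomp _ (hskew X g) (htr X g)).trans (sum_unitCoef_smul_suDir _).symm
  · rintro ⟨a, b, _ | _⟩ X g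
    · exact coefRe_comm_unitA (hskew X g) a b
    · exact coefIm_comm_unitB' (hskew X g) a b
  · rintro ⟨a, b, _ | _⟩
    · exact preservesPoly_re_entry (ι := ι) (fundamentalLatticeRep N) a b (1 / 2)
    · exact preservesPoly_im_entry (ι := ι) (fundamentalLatticeRep N) a b (1 / 2)
  · intro i a j g _ hg f hf
    have h2 := coef_adjDir_mem_wordTruncation_two_suN (ι := ι) N i a j hg
    have h := mul_mem_wordTruncation_add _ h2 hf
    rwa [add_comm] at h

end SuN

end Summit.QuantumFields.GaugeBoot

end
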